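import Literature.AlgebraicGeometry.HodgeTheory.MonomialSupportedHypersurfaceMonodromy
import Literature.AlgebraicGeometry.HodgeTheory.MonomialSupportedHypersurfaceFamilyPoints
import Literature.AlgebraicGeometry.HodgeTheory.DworkSexticSingletonRankOfFamily
import Literature.AlgebraicGeometry.HodgeTheory.DworkSexticSingletonPurity
import HarnessLib

/-!
# The `Γ_W`-equivariant transport from the Dwork sextic `X_ψ` to the Fermat point
# (Katz 2009, §3 and Lemma 3.1(1): "the eigensheaves are local systems")

Family `hodge`, layer `Literature/AlgebraicGeometry/HodgeTheory`; theorems only (no definition, no named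
fact; D-0026). This file DISCHARGES the topological hypothesis of `DworkSexticSingletonRankOfTransport`
/ `DworkSexticSingletonRankOfFamily` / `DworkSexticSingletonPurity` (crux K2
`FlatClassesSpannedByReflectionInvariants`, stmt-HodgeConjecture-20241, of route
`HodgeConjecture/DworkReflectionQuotients`): for every `ψ` with `ψ⁶ ≠ 1` there is an injective `ℂ`-linear
`T : H⁴(X_ψ(ℂ); ℂ) → H⁴(X⁴₆(ℂ); ℂ)` intertwining the diagonal symmetries `g_a`, `a ∈ Γ_W = μ₆⁶ ∩ ker ∏`
(`DworkSextic.exists_equivariant_transport`). Consequently Katz's rank bound for the singleton type holds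
unconditionally (`DworkSextic.singleton_rank_le_one`), the 360 singleton flat eigenlines
`V_{(1,2,3,3,4,5)∘σ}(X_ψ)` are of Hodge type `(2,2)` (`DworkSextic.isOfHodgeType_two_two_singleton`), and the
`j = 0` instance of crux K2 holds with NO hypothesis (`DworkSextic.flatClasses_mem_span_reflInvariant_singleton`).

THE CONSTRUCTION (Katz §3: "the group `Γ_W` acts as automorphisms of `𝕏/𝔸¹`"; Voisin II §3.1.2). Let
`M` be the set of sextic monomials in `x₀,…,x₅` fixed by `Γ_W` (it contains the `xᵢ⁶` and `∏ xᵢ`, so the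
Dwork form `F_ψ = Σ xᵢ⁶ − 6ψ ∏ xᵢ` and the Fermat form are supported on `M`: a form invariant under `Γ_W`
has no coefficient at a monomial moved by `Γ_W`, `coeff_eq_zero_of_not_fixed`). The tree's monomial-supported
family `π_M : 𝒴_M → S_M` (`Motives/MonomialSupportedHypersurfaceFamily`; smooth projective, Ehresmann-locally
trivial on all of `S_M(ℂ)`, `isCohomologicallyLocallyTrivialOn_familyM`) carries the relative diagonal
automorphisms `σ_a`, `a ∈ Γ_W`, OVER THE BASE (`Motives/MonomialSupportedHypersurfaceSymmetry.sigmaM`), whose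
fibre maps are the diagonal automorphisms `diagonalAut` of the members under the embedding-compatible fibre
isomorphisms (`sigmaMFiber_comp_eq_diagonalAut`). A path from `ψ` to `0` in `ℂ ∖ μ₆` (the complement of a
finite set in the plane is path connected) gives a path of nonsingular `Γ_W`-invariant sextics `F_{ψ(t)}` in
`U(ℂ)` through the coefficient chart (`continuous_pointOfCoeffs_comp`), which lifts to `S_M(ℂ)`
(`exists_path_lift_toBase`); `F_0 = Σ xᵢ⁶` is the Fermat form. Then
`DworkSextic.exists_equivariant_transport_of_family` (parallel transport composed with the fibre
isomorphisms, `transportFun_map_fiberHom`) is the transport.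

## References

* [Katz2009] N. M. Katz, Another look at the Dwork family, Progr. Math. 270 (2009), §3 p. 92, Lemma 3.1(1).
* [VoisinHodgeI2002] C. Voisin, Hodge Theory and Complex Algebraic Geometry I (2002), Thm. 9.3, §9.2.1.
* [VoisinHodgeII2003] C. Voisin, Hodge Theory and Complex Algebraic Geometry II (2003), §3.1.2, §6.2.1.
-/

noncomputable section

open CategoryTheory MvPolynomial Finset
open scoped BigOperators

namespace Literature.AlgebraicGeometry.HodgeTheory.DworkSextic

open Literature.AlgebraicGeometry.Motives Literature.AlgebraicTopology.SingularHomology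
open Literature.AlgebraicGeometry.Motives.UniversalHypersurface
open Literature.AlgebraicGeometry.HodgeTheory.UniversalHypersurface

/-! ### The `Γ_W`-fixed sextic monomials -/

/-- The diagonal substitution of the torus-action file is the tree's `diagonalSubst` (`rfl`). [folklore] -/
private theorem diagSubstK_eq (a : Fin (4 + 2) → ℂˣ) : diagSubstK ℂ 4 a = diagonalSubst a := rfl

/-- Coefficients transform by the weight under a diagonal substitution:
`coeff_m F(a • x) = a^m · coeff_m F`. [cite: Katz2009, §3] -/
private theorem coeff_aeval_diagSubstK (a : Fin (4 + 2) → ℂˣ) (G : MvPolynomial (Fin (4 + 2)) ℂ)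
    (m : Fin (4 + 2) →₀ ℕ) :
    coeff m (aeval (diagSubstK ℂ 4 a) G) = ((unitWeight ℂ 4 a m : ℂˣ) : ℂ) * coeff m G := by
  classical
  conv_lhs => rw [G.as_sum, map_sum]
  simp_rw [aeval_diagSubstK_monomial, coeff_sum, coeff_monomial]
  rw [Finset.sum_ite_eq']
  split_ifs with h
  · rfl
  · rw [notMem_support_iff.mp h, mul_zero]

/-- **A `Γ_W`-invariant form has no coefficient at a monomial moved by `Γ_W`**: if `a ∈ Γ_W` stabilises
`G` for all `a` and `a^m ≠ 1` for some `a ∈ Γ_W`, then `coeff_m G = 0`. So every `Γ_W`-invariant sextic is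
supported on the `Γ_W`-fixed monomials. [cite: Katz2009, §3] -/
theorem coeff_eq_zero_of_not_fixed {G : MvPolynomial (Fin (4 + 2)) ℂ} (hG : gammaW ≤ diagonalStabilizer G)
    {m : DegIndex 4 6} (hm : m ∉ {m : DegIndex 4 6 | ∀ a : gammaW, unitWeight ℂ 4 (a : Fin (4 + 2) → ℂˣ) m.1 = 1}) :
    coeff m.1 G = 0 := by
  simp only [Set.mem_setOf_eq, not_forall] at hm
  obtain ⟨a, ha⟩ := hm
  have hinv : aeval (diagSubstK ℂ 4 (a : Fin (4 + 2) → ℂˣ)) G = G := by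
    rw [diagSubstK_eq]; exact mem_diagonalStabilizer_iff.mp (hG a.2)
  have h := coeff_aeval_diagSubstK (a : Fin (4 + 2) → ℂˣ) G m.1
  rw [hinv] at h
  have h' : ((((unitWeight ℂ 4 (a : Fin (4 + 2) → ℂˣ) m.1 : ℂˣ) : ℂ)) - 1) * coeff m.1 G = 0 := by
    rw [sub_mul, one_mul, ← h, sub_self]
  refine (mul_eq_zero.mp h').resolve_left (sub_ne_zero.mpr fun h1 => ha (Units.val_injective ?_))
  rw [h1, Units.val_one]

/-- The Dwork form `F_ψ` is supported on the `Γ_W`-fixed sextic monomials. [cite: Katz2009, §3] -/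
theorem isSupportedOn_form (ψ : ℂ) :
    IsSupportedOn 4 6 {m : DegIndex 4 6 | ∀ a : gammaW, unitWeight ℂ 4 (a : Fin (4 + 2) → ℂˣ) m.1 = 1} (form ψ) :=
  fun _ hm => coeff_eq_zero_of_not_fixed (gammaW_le_diagonalStabilizer ψ) hm

/-- The Fermat sextic form is supported on the `Γ_W`-fixed sextic monomials. [cite: Katz2009, §3] -/
theorem isSupportedOn_fermat :
    IsSupportedOn 4 6 {m : DegIndex 4 6 | ∀ a : gammaW, unitWeight ℂ 4 (a : Fin (4 + 2) → ℂˣ) m.1 = 1}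
      (fermatPolynomial ℂ 4 6) :=
  fun _ hm => coeff_eq_zero_of_not_fixed gammaW_le_diagonalStabilizer_fermat hm

/-- The Fermat sextic form is nonsingular. [cite: Hartshorne1977, I Ex. 5.5] -/
theorem isNonsingularForm_fermat : SmoothHypersurface.IsNonsingularForm ℂ (fermatPolynomial ℂ 4 6) :=
  SmoothHypersurface.isNonsingularForm_sum_X_pow (by norm_num)

/-- `F_0 = Σ xᵢ⁶`: the member of the Dwork pencil at `ψ = 0` is the Fermat sextic. [cite: Katz2009, §3] -/
theorem form_zero : form 0 = fermatPolynomial ℂ 4 6 := by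
  simp [form, fermatPolynomial]

/-! ### A path of nonsingular `Γ_W`-invariant sextics from `F_ψ` to the Fermat form -/

/-- **`ℂ ∖ μ₆` is path connected**: for `ψ⁶ ≠ 1` there is a path from `ψ` to `0` avoiding the sixth
roots of unity (the complement of a finite set in the plane). [folklore] -/
private theorem exists_path_avoiding_roots {ψ : ℂ} (hψ : ψ ^ 6 ≠ 1) :
    ∃ c : Path ψ 0, ∀ t, (c t) ^ 6 ≠ 1 := by
  have hfin : ({z : ℂ | z ^ 6 = 1}).Finite := by
    refine (Polynomial.nthRoots 6 (1 : ℂ)).toFinset.finite_toSet.subset fun z hz => ?_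
    simp only [Set.mem_setOf_eq] at hz
    simp [Multiset.mem_toFinset, Polynomial.mem_nthRoots, hz]
  have hpc : IsPathConnected ({z : ℂ | z ^ 6 = 1}ᶜ) :=
    hfin.countable.isPathConnected_compl_of_one_lt_rank (by rw [Complex.rank_real_complex]; norm_num)
  have h0 : (0 : ℂ) ∈ ({z : ℂ | z ^ 6 = 1}ᶜ) := by simp
  have hψ' : ψ ∈ ({z : ℂ | z ^ 6 = 1}ᶜ) := hψ
  obtain ⟨c, hc⟩ := hpc.joinedIn ψ hψ' 0 h0
  exact ⟨c, fun t => hc t⟩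

/-- The coefficient vector of `F_z` depends continuously on `z`. [folklore] -/
private theorem continuous_coeff_form :
    Continuous fun z : ℂ => fun m : DegIndex 4 6 => coeff m.1 (form z) := by
  refine continuous_pi fun m => ?_
  have h : ∀ z : ℂ, coeff m.1 (form z) =
      coeff m.1 (∑ i : Fin 6, (X i : MvPolynomial (Fin 6) ℂ) ^ 6) -
        (6 * z) * coeff m.1 (∏ i : Fin 6, (X i : MvPolynomial (Fin 6) ℂ)) := fun z => by
    rw [form, coeff_sub, coeff_C_mul]
  simp_rw [h]
  fun_prop

/-! ### The equivariant transport -/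

variable {ψ : ℂ}

/-- Fibre isomorphisms of the `M`-supported family over the point of a form `G`, typed against `X_G`
itself and compatible with the embeddings into `ℙ⁵` (`exists_fiberIsoM_comp_hypersurfaceι` with
`pointFormM [G] = G`). [cite: VoisinHodgeII2003, §6.2.1] -/
private theorem exists_fiberIso_of_eq {M : Set (DegIndex 4 6)} (t : AlgPoints (baseM ℂ 4 6 M) ℂ)
    {G : MvPolynomial (Fin (4 + 2)) ℂ} (hG : pointFormM ℂ 4 6 M t = G) :
    ∃ e : fiberOver (familyM ℂ 4 6 M) t ≅ SmoothHypersurface.hypersurface G,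
      e.hom ≫ SmoothHypersurface.hypersurfaceι G = fiberToProjectiveSpace ℂ 4 6 M t := by
  subst hG
  exact exists_fiberIsoM_comp_hypersurfaceι ℂ 4 6 M (by norm_num) t

/-- **The `Γ_W`-equivariant transport to the Fermat point** (Katz's "the eigensheaves `Prim(V mod W)` are
local systems on `ψ⁶ ≠ 1`", made into a map): for `ψ⁶ ≠ 1` there is an injective `ℂ`-linear
`T : H⁴(X_ψ(ℂ); ℂ) → H⁴(X⁴₆(ℂ); ℂ)` with `T ∘ g_a^* = g_a^* ∘ T` for every `a ∈ Γ_W` — parallel transport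
in `R⁴(π_M)_*ℂ` along a path of `Γ_W`-invariant nonsingular sextics from `F_ψ` to `Σ xᵢ⁶`, conjugated by
the fibre isomorphisms. [cite: Katz2009, §3 p. 92 and Lemma 3.1(1)] [cite: VoisinHodgeII2003, §3.1.2]
[cite: VoisinHodgeI2002, §9.2.1] -/
theorem exists_equivariant_transport (hψ : ψ ^ 6 ≠ 1) :
    ∃ T : complexBetti (fibre ψ) (2 * 2) →ₗ[ℂ] complexBetti (fermatHypersurface 4 6) (2 * 2),
      Function.Injective T ∧
      ∀ (a : gammaW) (c : complexBetti (fibre ψ) (2 * 2)),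
        T (singularCohomology.map ℂ ℂ
            (diagonalMap (form ψ) (gammaW_le_diagonalStabilizer ψ a.2)) (2 * 2) c) =
          singularCohomology.map ℂ ℂ
            (diagonalMap (fermatPolynomial ℂ 4 6) (gammaW_le_diagonalStabilizer_fermat a.2)) (2 * 2) (T c) := by
  -- the family of `Γ_W`-invariant nonsingular sextics
  set M : Set (DegIndex 4 6) := {m | ∀ a : gammaW, unitWeight ℂ 4 (a : Fin (4 + 2) → ℂˣ) m.1 = 1} with hM
  have hfix : ∀ a : gammaW, FixesMonomials ℂ 4 6 M (a : Fin (4 + 2) → ℂˣ) := fun a m hm => hm a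
  -- the two points
  set t₁ : AlgPoints (baseM ℂ 4 6 M) ℂ :=
    pointOfFormM ℂ 4 6 M (isHomogeneous_form ψ) (isNonsingularForm_form hψ) (isSupportedOn_form ψ) with ht₁
  set t₂ : AlgPoints (baseM ℂ 4 6 M) ℂ :=
    pointOfFormM ℂ 4 6 M (isHomogeneous_fermatPolynomial 4 6) isNonsingularForm_fermat isSupportedOn_fermat
    with ht₂
  -- a path of nonsingular invariant sextics in `U(ℂ)` and its lift to `S_M(ℂ)`
  obtain ⟨c, hc⟩ := exists_path_avoiding_roots hψ
  have hJ : ∀ t, SmoothHypersurface.IsNonsingularForm ℂ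
      (formOfCoeffs (fun m : DegIndex 4 6 => coeff m.1 (form (c t)))) := fun t => by
    rw [formOfCoeffs_coeff _ (isHomogeneous_form (c t))]
    exact isNonsingularForm_form (hc t)
  have hcont : Continuous fun t => pointOfCoeffs ℂ 4 6 (fun m : DegIndex 4 6 => coeff m.1 (form (c t))) (hJ t) :=
    continuous_pointOfCoeffs_comp ℂ 4 6 (continuous_coeff_form.comp c.continuous) hJ
  have hends : ∀ {G : MvPolynomial (Fin (4 + 2)) ℂ} (hG : G.IsHomogeneous 6)
      (hGJ : SmoothHypersurface.IsNonsingularForm ℂ G) (hGM : IsSupportedOn 4 6 M G) (t : unitInterval)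
      (hGt : form (c t) = G),
      pointOfCoeffs ℂ 4 6 (fun m : DegIndex 4 6 => coeff m.1 (form (c t))) (hJ t) =
        AlgPoints.map (toBase ℂ 4 6 M) (pointOfFormM ℂ 4 6 M hG hGJ hGM) := by
    intro G hG hGJ hGM t hGt
    rw [map_toBase_pointOfFormM]
    apply coeffVector_injective ℂ 4 6
    rw [coeffVector_pointOfCoeffs]
    funext m
    rw [coeffVector_apply, pointForm_pointOfForm, hGt]
  have hstart := hends (isHomogeneous_form ψ) (isNonsingularForm_form hψ) (isSupportedOn_form ψ) 0
    (by rw [c.source])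
  have hend := hends (isHomogeneous_fermatPolynomial 4 6) isNonsingularForm_fermat isSupportedOn_fermat 1
    (by rw [c.target, form_zero])
  let γ₀ : Path (AlgPoints.map (toBase ℂ 4 6 M) t₁) (AlgPoints.map (toBase ℂ 4 6 M) t₂) :=
    { toFun := fun t => pointOfCoeffs ℂ 4 6 (fun m : DegIndex 4 6 => coeff m.1 (form (c t))) (hJ t)
      continuous_toFun := hcont
      source' := hstart
      target' := hend }
  have hγ₀ : ∀ u, IsSupportedOn 4 6 M (pointForm ℂ 4 6 (γ₀ u)) := fun u => by
    change IsSupportedOn 4 6 M (pointForm ℂ 4 6 (pointOfCoeffs ℂ 4 6 _ (hJ u)))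
    rw [pointForm_pointOfCoeffs, formOfCoeffs_coeff _ (isHomogeneous_form (c u))]
    exact isSupportedOn_form (c u)
  obtain ⟨γ', -⟩ := exists_path_lift_toBase ℂ 4 6 M γ₀ hγ₀
  -- as a path in the (whole) cohomologically locally trivial locus
  let s₁ : (Set.univ : Set (ComplexPoints (baseM ℂ 4 6 M))) := ⟨t₁, trivial⟩
  let s₂ : (Set.univ : Set (ComplexPoints (baseM ℂ 4 6 M))) := ⟨t₂, trivial⟩
  let γ'' : Path s₁ s₂ :=
    { toFun := fun u => ⟨γ' u, trivial⟩
      continuous_toFun := γ'.continuous.subtype_mk _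
      source' := Subtype.ext γ'.source
      target' := Subtype.ext γ'.target }
  -- fibre isomorphisms compatible with the embeddings, and the fibre maps of `σ_a`
  obtain ⟨e₁, he₁⟩ := exists_fiberIso_of_eq t₁ (pointFormM_pointOfFormM ℂ 4 6 M _ _ _)
  obtain ⟨e₂, he₂⟩ := exists_fiberIso_of_eq t₂ (pointFormM_pointOfFormM ℂ 4 6 M _ _ _)
  exact exists_equivariant_transport_of_family (familyM ℂ 4 6 M)
    (isCohomologicallyLocallyTrivialOn_familyM 4 6 M (by norm_num) (by norm_num)) (s₁ := s₁) (s₂ := s₂) ⟦γ''⟧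
    (fun a => sigmaM ℂ 4 6 M (a : Fin (4 + 2) → ℂˣ) (hfix a)) (fun a => sigmaM_comp_familyM ℂ 4 6 M _ (hfix a))
    (fun a t => sigmaMFiber ℂ 4 6 M (a : Fin (4 + 2) → ℂˣ) (hfix a) t)
    (fun a t => sigmaMFiber_comp_fiberι ℂ 4 6 M _ (hfix a) t) e₁ e₂
    (fun a => sigmaMFiber_comp_eq_diagonalAut 4 6 M _ (hfix a) t₁ e₁ he₁ (gammaW_le_diagonalStabilizer ψ a.2))
    (fun a => sigmaMFiber_comp_eq_diagonalAut 4 6 M _ (hfix a) t₂ e₂ he₂ (gammaW_le_diagonalStabilizer_fermat a.2))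

/-- **Katz's rank bound for the singleton type, unconditionally**: for `ψ⁶ ≠ 1` and `σ ∈ 𝔖₆`, the
eigenspace `V_{χ_{(1,2,3,3,4,5)∘σ}} ⊆ H⁴(X_ψ(ℂ); ℂ)` lies in a line (Lemma 3.1(1): rank
`#{totally nonzero translates} = 1`). [cite: Katz2009, Lemma 3.1(1)] -/
theorem singleton_rank_le_one (hψ : ψ ^ 6 ≠ 1) (σ : Equiv.Perm (Fin 6)) :
    ∃ v, diagonalCharacterEigenspace (form ψ) gammaW (character fun k => flatTypes 0 (σ k)) (2 * 2) ≤ ℂ ∙ v := by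
  obtain ⟨T, hT, hTeq⟩ := exists_equivariant_transport hψ
  exact singleton_rank_le_one_of_equivariant_transport T hT hTeq σ

/-- **The singleton flat eigenlines of `X_ψ` are of Hodge type `(2,2)`, unconditionally** (Katz's
Lemma 3.1(2) for the type `(1,2,3,3,4,5) ∘ σ` and its conjugate, `ψ⁶ ≠ 1`): symmetry and rank one
(`isOfHodgeType_two_two_singleton_of_rank_le_one`) with the rank now a theorem. [cite: Katz2009, Lemma 3.1] -/
theorem isOfHodgeType_two_two_singleton (hψ : ψ ^ 6 ≠ 1) (σ : Equiv.Perm (Fin 6))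
    {u v : complexBetti (fibre ψ) (2 * 2)}
    (hu : IsEig ψ (fun l => flatTypes 0 (σ l)) u) (hv : IsEig ψ (fun l => 6 - flatTypes 0 (σ l)) v) :
    IsOfHodgeType 4 (fibre ψ) (2 * 2) 2 2 u ∧ IsOfHodgeType 4 (fibre ψ) (2 * 2) 2 2 v :=
  isOfHodgeType_two_two_singleton_of_rank_le_one hψ σ (singleton_rank_le_one hψ) hu hv

/-- **Crux K2 for the singleton type `(1,2,3,3,4,5)`, with no hypothesis**: for `ψ⁶ ≠ 1`, `σ ∈ 𝔖₆` and
every RATIONAL class `w = u + v` with `u` an eigenclass of exponent `(1,2,3,3,4,5) ∘ σ` and `v` one of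
exponent `(6 − (1,2,3,3,4,5)) ∘ σ`, `w` lies in the `ℂ`-span of the rational `(2,2)`-classes fixed by a
realised reflection `s_(i,i',ζ)` (`flatClasses_mem_span_reflInvariant_singleton_of_rank_le_one` with the
rank now a theorem). This is the `j = 0` instance (360 of the 1170 flat classes) of the body of
`FlatClassesSpannedByReflectionInvariants` of route `DworkReflectionQuotients`.
[cite: Katz2009, Lemma 3.1 and §2 pp. 5–7] [cite: BiniGarbagnati2012, §3.4] -/
theorem flatClasses_mem_span_reflInvariant_singleton (hψ : ψ ^ 6 ≠ 1) (σ : Equiv.Perm (Fin 6))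
    (w : complexBetti (fibre ψ) (2 * 2)) (hrat : IsRationalClass w)
    (huv : ∃ u v : complexBetti (fibre ψ) (2 * 2), IsEig ψ (fun l => flatTypes 0 (σ l)) u ∧
      IsEig ψ (fun l => 6 - flatTypes 0 (σ l)) v ∧ w = u + v) :
    w ∈ Submodule.span ℂ {c : complexBetti (fibre ψ) (2 * 2) | IsRationalClass c ∧
      IsOfHodgeType 4 (fibre ψ) (2 * 2) 2 2 c ∧ ∃ i i' : Fin 6, i ≠ i' ∧ ∃ ζ : ℂ, ζ ^ 6 = 1 ∧
        ∃ g : C(Motives.ComplexPoints (fibre ψ), Motives.ComplexPoints (fibre ψ)),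
          (∀ x, ∃ t : ℂ, (pt ψ (g x)).rep = t • (fun k => if k = i then ζ * (pt ψ x).rep i'
            else if k = i' then ζ⁻¹ * (pt ψ x).rep i else (pt ψ x).rep k)) ∧
          singularCohomology.map ℂ ℂ g (2 * 2) c = c} :=
  flatClasses_mem_span_reflInvariant_singleton_of_rank_le_one hψ σ (singleton_rank_le_one hψ) w hrat huv

end Literature.AlgebraicGeometry.HodgeTheory.DworkSextic

end
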